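import Mathlib.Analysis.Distribution.SchwartzSpace.Fourier
import Literature.Algebra.EuclideanLattices.E8Lattice
import Literature.MathematicalPhysics.StatisticalMechanics.PeriodicConfigurationSums
import Literature.NumberTheory.LFunctions.DedekindZetaPoissonProofs
import HarnessLib

/-!
# `E₈` as a periodic configuration of `ℝ⁸`; Poisson summation over `Λ₈`

Topic: `Literature/MathematicalPhysics/StatisticalMechanics`. Requested (work item `wi-12364`) by
the route `ZeroPressureMagicLadder` of `AtomisticToContinuum/Crystallization`, crux `E8Rung`
(`∃ P : PeriodicConfiguration 8, P.energyPerParticle V₁₂ = -g(0)/2`, expected `P = E₈` at its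
equilibrium scale): "E₈ as a `PeriodicConfiguration 8` / even unimodular lattice of min norm `√2`
(Viazovska 2017) with Poisson summation over it". The lattice `Λ₈` itself (even, unimodular,
self-dual, minimal norm `2`, norms `√(2n)`) is `Literature.Algebra.EuclideanLattices.E8.lattice`
(`E8Lattice.lean`, all proved); the CKMRV interpolation theorem with nodes `√(2n)` is in
`Literature/Analysis/Fourier/RadialSchwartzInterpolation.lean`.

## What is here (all proved; no named facts)

* `e8Configuration : PeriodicConfiguration 8` — lattice of periods `Λ₈`, motif `{0}` (a Bravais
  lattice, Blanc–Lewin §2.1); `e8Configuration_points : points = Λ₈`;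
  `energyPerParticle_e8Configuration : e_V(E₈) = ½ ∑'_{x ∈ Λ₈ ∖ 0} V(‖x‖)` (Blanc–Lewin (23)).
* `exists_dist_eq_sqrt_of_mem_points`, `exists_mem_points_norm_eq_sqrt` — the pair distances of
  `E₈` are exactly the `√(2n)`, `n ≥ 1` (the CKMRV interpolation nodes for `d = 8`).
* `summable_inv_pow_norm_e8Lattice` (`‖x‖⁻ⁿ`, `n > 8`, summable over `Λ₈ ∖ 0`),
  `hasSum_mie_e8Configuration` (the crux's Mie `(24,12)` energy of `E₈` is a genuine sum).
* `tsum_e8Lattice_eq_tsum_fourier` — **Poisson summation over `Λ₈`**: for Schwartz `f` on `ℝ⁸`,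
  `∑_{x ∈ Λ₈} f(x) = ∑_{x ∈ Λ₈} f̂(x)` (Viazovska 2017, §2; `f̂(ξ) = ∫ f(x) e^{-2πi⟨x,ξ⟩} dx`,
  Mathlib `𝓕`), from the tree's general Poisson summation formula for lattices
  (`Literature.NumberTheory.LFunctions.Fourier.poissonSummation_zlattice_holds`, Neukirch VII
  (3.2)) with `covol(Λ₈) = 1` and `Λ₈* = Λ₈`; variants for Mathlib's Schwartz-level `𝓕` and for
  the point set of `e8Configuration`.

Not here: dilated configurations `s·E₈` (the crux's "equilibrium scale") and the rescaled
formula `∑_{x ∈ sΛ₈} f(x) = s⁻⁸ ∑_{y ∈ s⁻¹Λ₈} f̂(y)` (apply the general formula to the lattice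
`sΛ₈`, or this one to the dilate `f(s·)`), shell-by-shell energy sums (theta series
`Θ_{Λ₈} = E₄`), Viazovska's magic function and the Cohn–Elkies bound.

## References

* M. S. Viazovska, *The sphere packing problem in dimension 8*, Ann. of Math. 185 (2017)
  991–1015, arXiv:1603.04246: §1 (`Λ₈`), §2 (Poisson summation over `Λ₈`). [Viazovska2017]
* H. Cohn, A. Kumar, S. D. Miller, D. Radchenko, M. Viazovska, Ann. of Math. 196 (2022),
  arXiv:1902.05438, §1.1 and §1.4. [CohnEtAl2019]
* X. Blanc, M. Lewin, *The crystallization conjecture: a review*, EMS Surv. Math. Sci. 2 (2015),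
  §2.1 (17)–(18), (23). [BlancLewin2015]
* J. Neukirch, *Algebraic Number Theory*, Ch. VII (3.2) (the Poisson summation formula used).
  [NeukirchANT1999]
-/

noncomputable section

open scoped SchwartzMap FourierTransform BigOperators
open Literature.Algebra.EuclideanLattices

namespace Literature.MathematicalPhysics.StatisticalMechanics

/-- Euclidean `8`-space. -/
local notation "E" => EuclideanSpace ℝ (Fin 8)

/-- **`E₈` as a periodic configuration** of the summit statement's type
(`PeriodicConfiguration 8`: lattice of periods + finite motif): lattice `Λ₈`
(`Literature.Algebra.EuclideanLattices.E8.lattice`), one-point motif `{0}` — a Bravais lattice in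
the sense of Blanc–Lewin §2.1 ("the case `#F = 1`"). [cite: BlancLewin2015, §2.1 (17)–(18)] -/
def e8Configuration : PeriodicConfiguration 8 where
  lattice := E8.lattice
  discrete := inferInstance
  isZLattice := inferInstance
  motif := {0}
  motif_nonempty := ⟨0, by simp⟩
  eq_of_sub_mem := by
    intro x hx y hy _
    rw [Finset.mem_singleton] at hx hy
    rw [hx, hy]

/-- The lattice of periods of `e8Configuration` is `Λ₈`. [folklore] -/
@[simp] theorem e8Configuration_lattice : e8Configuration.lattice = E8.lattice := rfl

/-- The motif of `e8Configuration` is `{0}`. [folklore] -/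
@[simp] theorem e8Configuration_motif : e8Configuration.motif = {0} := rfl

/-- The point set of `e8Configuration` is `Λ₈`. [folklore] -/
theorem e8Configuration_points : e8Configuration.points = (E8.lattice : Set E) := by
  ext z
  simp only [PeriodicConfiguration.points, e8Configuration_motif, Finset.mem_singleton,
    Set.mem_setOf_eq, SetLike.mem_coe]
  constructor
  · rintro ⟨y, rfl, g, hg, rfl⟩
    simpa using hg
  · intro hz
    exact ⟨0, rfl, z, hz, by simp⟩

/-- **Energy per particle of `E₈`**: `e_V(Λ₈) = ½ ∑_{x ∈ Λ₈ ∖ 0} V(‖x‖)` (Blanc–Lewin (23) for a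
Bravais lattice; Cohn–Kumar–Miller–Radchenko–Viazovska §1.1: the energy of a lattice is the sum of
the potential over its nonzero vectors, per particle with the factor `½` of unordered pairs in the
Blanc–Lewin normalisation). A `tsum` (junk `0` if `V ∘ ‖·‖` is not summable over `Λ₈ ∖ 0`).
[cite: BlancLewin2015, §2.1 (23)] -/
theorem energyPerParticle_e8Configuration (V : ℝ → ℝ) :
    e8Configuration.energyPerParticle V =
      (1 / 2) * ∑' x : {x : E // x ∈ E8.lattice ∧ x ≠ 0}, V ‖x.1‖ := by
  have hset : {y : E | y ∈ e8Configuration.points ∧ y ≠ 0} = {x : E | x ∈ E8.lattice ∧ x ≠ 0} := by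
    rw [e8Configuration_points]; rfl
  unfold PeriodicConfiguration.energyPerParticle
  rw [e8Configuration_motif, Finset.sum_singleton, Finset.card_singleton]
  rw [show (∑' y : {y : E // y ∈ e8Configuration.points ∧ y ≠ 0}, V (dist (0 : E) y.1))
      = ∑' y : ↥{y : E | y ∈ e8Configuration.points ∧ y ≠ 0}, V (dist (0 : E) y.1) from rfl,
    tsum_congr_set_coe (fun y => V (dist (0 : E) y)) hset]
  rw [show (∑' x : {x : E // x ∈ E8.lattice ∧ x ≠ 0}, V ‖x.1‖)
      = ∑' x : ↥{x : E | x ∈ E8.lattice ∧ x ≠ 0}, V ‖x.1‖ from rfl]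
  simp only [dist_zero_left]
  norm_num

/-- **Distances in `E₈` are the `√(2n)`, `n ≥ 1`**: any two distinct points of the configuration
are at distance `√(2n)` for some integer `n ≥ 1` (the interpolation nodes of CKMRV Theorem 1.7 for
`d = 8`; CKMRV §1.4). [cite: CohnEtAl2019, §1.4] -/
theorem exists_dist_eq_sqrt_of_mem_points {x y : E} (hx : x ∈ e8Configuration.points)
    (hy : y ∈ e8Configuration.points) (hxy : x ≠ y) :
    ∃ n : ℕ, 1 ≤ n ∧ dist x y = Real.sqrt (2 * n) := by
  rw [e8Configuration_points, SetLike.mem_coe] at hx hy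
  obtain ⟨n, hn, h⟩ := E8.exists_norm_eq_sqrt (sub_mem hx hy) (sub_ne_zero.2 hxy)
  exact ⟨n, hn, by rw [dist_eq_norm, h]⟩

/-- Every node `√(2n)`, `n ≥ 1`, is a distance from the origin in `E₈`. [cite: CohnEtAl2019, §1.4] -/
theorem exists_mem_points_norm_eq_sqrt {n : ℕ} (hn : 1 ≤ n) :
    ∃ x ∈ e8Configuration.points, x ≠ 0 ∧ ‖x‖ = Real.sqrt (2 * n) := by
  obtain ⟨x, hx, hx0, h⟩ := E8.exists_mem_norm_eq_sqrt hn
  exact ⟨x, by rw [e8Configuration_points]; exact hx, hx0, h⟩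

/-- **No junk in `e_V(E₈)` for inverse powers `> 8`**: `x ↦ ‖x‖⁻ⁿ`, `n > 8`, is summable over
`Λ₈ ∖ 0` (Epstein zeta convergence; `PeriodicConfiguration.summable_inv_pow_dist`). [folklore] -/
theorem summable_inv_pow_norm_e8Lattice {n : ℕ} (hn : 8 < n) :
    Summable fun x : {x : E // x ∈ E8.lattice ∧ x ≠ 0} => (‖x.1‖⁻¹) ^ n := by
  have h := e8Configuration.summable_inv_pow_dist hn 0
  simp only [dist_zero_left] at h
  let e : {x : E // x ∈ E8.lattice ∧ x ≠ 0} ≃ {y : E // y ∈ e8Configuration.points ∧ y ≠ 0} :=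
    Equiv.subtypeEquivRight fun x => by rw [e8Configuration_points]; rfl
  exact e.summable_iff.2 h

/-- In particular the Mie `(24, 12)` lattice sum of the route's crux `E8Rung`,
`V₁₂(r) = r⁻²⁴/24 - r⁻¹²/12`, is summable over `Λ₈ ∖ 0`, so that
`e_{V₁₂}(E₈) = ½ ∑_{x ∈ Λ₈ ∖ 0} V₁₂(‖x‖)` is a genuine sum. [folklore] -/
theorem hasSum_mie_e8Configuration :
    HasSum (fun x : {x : E // x ∈ E8.lattice ∧ x ≠ 0} =>
        (1 / 2 : ℝ) * ((1 / 24) * (‖x.1‖⁻¹) ^ 24 - (1 / 12) * (‖x.1‖⁻¹) ^ 12))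
      (e8Configuration.energyPerParticle fun r => (1 / 24) * (r⁻¹) ^ 24 - (1 / 12) * (r⁻¹) ^ 12) := by
  rw [energyPerParticle_e8Configuration]
  refine (Summable.hasSum ?_).mul_left (1 / 2)
  exact ((summable_inv_pow_norm_e8Lattice (by norm_num)).mul_left (1 / 24)).sub
    ((summable_inv_pow_norm_e8Lattice (by norm_num)).mul_left (1 / 12))

/-! ## Poisson summation over `Λ₈` -/

/-- Transport of a lattice sum along an equality of lattices. [folklore] -/
theorem tsum_subtype_congr {L₁ L₂ : Submodule ℤ E} (h : L₁ = L₂) (F : E → ℂ) :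
    ∑' g : L₁, F g = ∑' g : L₂, F g := by
  subst h; rfl

/-- **Poisson summation over `E₈`** (Viazovska 2017, §2: "The Poisson summation formula states
`∑_{ℓ ∈ Λ₈} g(ℓ) = ∑_{ℓ ∈ Λ₈} ĝ(ℓ)`"; CKMRV §1.4: "Poisson summation over `E₈` … gives such a
relation between `f(√(2n))` and `f̂(√(2n))` for `n ≥ 0`"): for every Schwartz function `f` on `ℝ⁸`,
`∑_{x ∈ Λ₈} f(x) = ∑_{x ∈ Λ₈} f̂(x)`, `f̂ = 𝓕 f` with kernel `e^{-2πi⟨x,ξ⟩}`. PROVED from the tree's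
Poisson summation formula for lattices (`poissonSummation_zlattice_holds`, Neukirch VII (3.2)) with
`covol(Λ₈) = 1` and `Λ₈* = Λ₈` (`E8.covolume_eq_one`, `E8.dualLattice_eq`); both series converge
absolutely. [cite: Viazovska2017, §2 (Poisson summation over Λ₈)] -/
theorem tsum_e8Lattice_eq_tsum_fourier (f : 𝓢(E, ℂ)) :
    ∑' x : E8.lattice, f x = ∑' x : E8.lattice, 𝓕 (⇑f) x := by
  have h := Literature.NumberTheory.LFunctions.Fourier.poissonSummation_zlattice_holds E
    E8.lattice f
  rw [E8.covolume_eq_one, inv_one, one_smul] at h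
  rw [h]
  exact tsum_subtype_congr E8.dualLattice_eq _

/-- The same with Mathlib's Fourier transform on Schwartz space (`𝓕 f : 𝓢(ℝ⁸, ℂ)`,
`SchwartzMap.fourier_coe`). [cite: Viazovska2017, §2 (Poisson summation over Λ₈)] -/
theorem tsum_e8Lattice_eq_tsum_fourier' (f : 𝓢(E, ℂ)) :
    ∑' x : E8.lattice, f x = ∑' x : E8.lattice, (𝓕 f : 𝓢(E, ℂ)) x :=
  tsum_e8Lattice_eq_tsum_fourier f

/-- Poisson summation over the point set of `e8Configuration` (= `Λ₈`).
[cite: Viazovska2017, §2 (Poisson summation over Λ₈)] -/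
theorem tsum_points_e8Configuration_eq_tsum_fourier (f : 𝓢(E, ℂ)) :
    ∑' x : e8Configuration.points, f x = ∑' x : e8Configuration.points, 𝓕 (⇑f) x := by
  rw [show (∑' x : e8Configuration.points, f x) = ∑' x : ↥(E8.lattice : Set E), f x by
      rw [e8Configuration_points],
    show (∑' x : e8Configuration.points, 𝓕 (⇑f) x) = ∑' x : ↥(E8.lattice : Set E), 𝓕 (⇑f) x by
      rw [e8Configuration_points]]
  exact tsum_e8Lattice_eq_tsum_fourier f

end Literature.MathematicalPhysics.StatisticalMechanics
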